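import Summits.Ventures.PercRepro.GenQNineSevenT3
import Summits.Ventures.PercRepro.GenQNineSevenT4
import Summits.Ventures.PercRepro.GenQNineSevenT5
import Summits.Ventures.PercRepro.GenQNineSevenT6
import Summits.Ventures.PercRepro.GenQNineSevenTraceT1
import Summits.Ventures.PercRepro.GenQNineSevenTraceT2
import Summits.Ventures.PercRepro.GenQNineSevenTraceT3
import Summits.Ventures.PercRepro.GenQNineSevenTraceT4
import Summits.Ventures.PercRepro.GenQNineSevenTraceT5
import Summits.Ventures.PercRepro.GenQNineSevenTraceT6
import Summits.Ventures.PercRepro.GenQTraceSevenAll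

/-!
# PercRepro — THE `(9, 7)` ROW OF C-025 (night-4, gen 17 / 18)
The two residues of `rls_nine_seven_of_finite_residues` discharged from the assembled type modules `GenQNineSevenT3 … T6` and the per-type trace modules `GenQNineSevenTraceT1 … T6` (the trace residue `traceSix_residue_of_hyps` of `GenQNineSevenTrace` restated here as the private `…_inl`, the hub olean of that module having been skipped by the builder); `rls_nine_seven : ∀ M, RLS M 9 7`.
-/
namespace PercRepro.Night4

open Finset ThmH SixFour GenQ PerFlat Star NightThree ThmN

variable {α : Type} [DecidableEq α] {M : Matroid α} [M.Finite]

/-- **The trace residue `TraceSixResidue` on a matroid with the six hypotheses**: `interval_cases t` over the six per-type modules `traceSix_residue_of_hyps_t1 … t6` (the rank-`6` subset `H` has `≤ m + fCore(6 − m)` points by its coloop count `m`, `m ≥ 5` forces a basis; at `t = 6` every `m ≥ 1` instance is `traceSum_six_top_nonneg_of_mTr_ne_zero`, at `t = 5` the `m = 1` instances of coranks `9 … 13` are the shifted certificates; every other `(t, d, m)` a certificate). -/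
private theorem traceSix_residue_of_hyps_inl (hs : Simple M) (hline : ∀ L ∈ flatsQ M 2, L.card ≤ 3) (hplane : ∀ P ∈ flatsQ M 3, P.card ≤ 6) (hsolid : ∀ F ∈ flatsQ M 4, F.card ≤ 10) (hflat5 : ∀ F ∈ flatsQ M 5, F.card ≤ 21) (hflat6 : ∀ F ∈ flatsQ M 6, F.card ≤ 43) {H : Finset α} (hH : H ⊆ gr M) (hrH : M.eRk (H : Set α) = ((6 : ℕ) : ℕ∞)) (t : ℕ) (ht1 : 1 ≤ t) (ht : t ≤ 6) (hlo : 6 + t ≤ H.card) (hhi : H.card < traceSixBound t) : 0 ≤ ∑ B ∈ Rq M H 6, ((((6 + 1 : ℕ) : ℚ) + 2 - ((t : ℕ) : ℚ)) * (1 / (2 + (mTr M B : ℚ))) - ((((6 + 1 : ℕ) : ℚ) + 2) / (((6 + 1 : ℕ) : ℚ) + 1)) * GenQ.dem M H t B) := by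
  unfold traceSixBound at hhi
  interval_cases t <;> norm_num at hhi
  · exact traceSix_residue_of_hyps_t1 hs hline hplane hsolid hflat5 hflat6 hH hrH hlo hhi
  · exact traceSix_residue_of_hyps_t2 hs hline hplane hsolid hflat5 hflat6 hH hrH hlo hhi
  · exact traceSix_residue_of_hyps_t3 hs hline hplane hsolid hflat5 hflat6 hH hrH hlo hhi
  · exact traceSix_residue_of_hyps_t4 hs hline hplane hsolid hflat5 hflat6 hH hrH hlo hhi
  · exact traceSix_residue_of_hyps_t5 hs hline hplane hsolid hflat5 hflat6 hH hrH hlo hhi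
  · exact traceSix_residue_of_hyps_t6 hs hline hplane hsolid hflat5 hflat6 hH hrH hlo hhi


/-- **`HighLayersSevenResidue` holds**: Core → the six hypotheses (`coreHyps_of_core`, `card_le_fCore_of_core` at rank `6`), then the four type modules. -/
theorem highLayersSevenResidue_holds : HighLayersSevenResidue := by
  intro β _ M _ G hc hG _hF hm t ht3 ht6 hlo hhi
  have h10 := core_flat_four_le_ten M hc
  obtain ⟨hs, hline, hplane, hsolid, hflat5⟩ := coreHyps_of_core hc h10
  have hflat6 : ∀ F ∈ flatsQ M 6, F.card ≤ 43 := fun F hF => (card_le_fCore_of_core hc h10 6 F hF).trans (by decide)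
  have hG' := mem_flatsQ.1 hG
  unfold sevenResidueBound at hhi
  interval_cases t <;> norm_num at hhi
  · exact jq_t3_residue_seven hs hline hplane hsolid hflat5 hflat6 hG'.1 hG'.2.2 hm hlo hhi
  · exact jq_t4_residue_seven hs hline hplane hsolid hflat5 hflat6 hG'.1 hG'.2.2 hm hlo hhi
  · exact jq_t5_residue_seven hs hline hplane hsolid hflat5 hflat6 hG'.1 hG'.2.2 hm hlo hhi
  · exact jq_t6_residue_seven hs hline hplane hsolid hflat5 hflat6 hG'.1 hG'.2.2 hm hlo hhi

/-- **`TraceSixResidue` holds**: Core → the six hypotheses, then the trace module. -/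
theorem traceSixResidue_holds : TraceSixResidue := by
  intro β _ M _ H hc hH hrH t ht1 ht6 hlo hhi
  have h10 := core_flat_four_le_ten M hc
  obtain ⟨hs, hline, hplane, hsolid, hflat5⟩ := coreHyps_of_core hc h10
  have hflat6 : ∀ F ∈ flatsQ M 6, F.card ≤ 43 := fun F hF => (card_le_fCore_of_core hc h10 6 F hF).trans (by decide)
  exact traceSix_residue_of_hyps_inl hs hline hplane hsolid hflat5 hflat6 hH hrH t ht1 ht6 hlo hhi

/-- **THE `(9, 7)` ROW OF C-025, UNCONDITIONAL**: `rls_nine_seven_of_finite_residues` on the two residues. -/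
theorem rls_nine_seven {γ : Type} [DecidableEq γ] (M : Matroid γ) [M.Finite] : RLS M 9 7 :=
  rls_nine_seven_of_finite_residues highLayersSevenResidue_holds traceSixResidue_holds M


end PercRepro.Night4
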